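import Literature.NumberTheory.Automorphic.IwahoriUpMultiplicative
import Literature.NumberTheory.Automorphic.HidaTowerLevelsHecke
import HarnessLib

/-!
# `U`-operators at different places above `p` multiply: `[U g U] ∘ [U t_w^b U] = [U g t_w^b U]`

Topic `NumberTheory/Automorphic`; namespace `Literature.NumberTheory.Automorphic.BigHeckeGLn.TameLevel`;
theorems only, continuing `IwahoriUpMultiplicative` (same place: `[U t^a U][U t^b U] = [U t^{a+b} U]`)
across DIFFERENT places above `p`: at an Iwahori level `U = U(b', c)` of the `GL₂` Hida family
(`U` maximal above `p`, `w ∣ p`, `b ≤ c`) and for any `g ∈ GL₂(𝔸_K^∞)` with TRIVIAL `w`-component,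

* `mul_mul_heckeElement_pow_mem_doubleCosetQuot` — `g U t_w^b ⊆ U g t_w^b U`
  (every coset of `U t_w^b U / U` is `N_w(y) t_w^b U`, `exists_globalUnipotent_coset_eq`, and `g`
  commutes with the `w`-local `N_w(y)`);
* `coe_eq_coe_of_smul_eq_smul_of_localComponent_eq_one` — the separation hypothesis of the
  composition criterion `ArithmeticQuotient.heckeFun_comp_heckeFun`: `y • e = y' • e'` with
  `yU, y'U ∈ UgU/U`, `e, e' ∈ U t_w^b U/U` forces `yU = y'U` (normal form `l N_w(x) g t_w^b U`, then
  splitting an element of `U` into its `w`-part and the rest, `mem_level_of_mul_ofLocal_mem`);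
* hence **`heckeFun_level_comp_heckeElement_pow`: `[U g U] ∘ [U t_w^b U] = [U (g t_w^b) U]` on
  `Fun(GL₂(𝔸_K^∞) ⧸ U(b',c), M)`** and `heckeEnd_level_mul_heckeElement_pow_of_localComponent_eq_one`
  on `H^i(X_{U(b',c)}, M)` ([ShimuraIATAF1971, Ch. 3, Prop. 3.3]: `deg` is multiplicative on the
  positive monoid; [KhareThorne2017, §6.2, Lemma 6.5 (3)]);
* `upElement s r = ∏_{v ∈ s} t_{v,1}^r` (the factors commute, `commute_heckeElement_pow`) and
  **`heckeEnd_level_upElement`: `[U (∏_{v ∈ s} t_v^r) U] = ∏_{v ∈ s} U_{v,1}^r`** for `r ≤ c` and a set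
  `s` of places above `p` — the operator `U_p^{(r)}` of independence of weight for all places at
  once, whose ordinary part is the intersection of the `U_{v,1}`-ordinary parts
  (`OrdinaryPartOfFiniteModuleProd`).

## References

* G. Shimura, *Introduction to the arithmetic theory of automorphic functions* (1971), Ch. 3,
  Prop. 3.3. [ShimuraIATAF1971]
* C. Khare, J. A. Thorne, Amer. J. Math. 139 (2017), §6.2 Lemma 6.5, §6.4 (arXiv:1409.7007, held).
  [KhareThorne2017]
-/

noncomputable section

open CategoryTheory IsDedekindDomain NumberField

namespace Literature.NumberTheory.Automorphic.BigHeckeGLn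

variable {K : Type} [Field K] [NumberField K]

/-- Hecke elements `t_{v,1}^a`, `t_{w,1}^b` commute (same place: powers of one element; different
places: disjoint local supports). [folklore] -/
theorem commute_heckeElement_pow (v w : HeightOneSpectrum (𝓞 K)) (a b : ℕ) :
    Commute (heckeElement 2 K v 1 ^ a) (heckeElement 2 K w 1 ^ b) := by
  by_cases hvw : v = w
  · subst hvw
    exact (Commute.refl _).pow_pow a b
  · rw [heckeElement_one_pow_eq_ofLocal w b]
    exact mul_ofLocal_comm (by rw [heckeElement_one_pow_eq_ofLocal v a, localComponent_ofLocal_of_ne (Ne.symm hvw)]) _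

namespace TameLevel

variable {p : ℕ} [Fact p.Prime] (𝒰 : TameLevel 2 K p) {w : HeightOneSpectrum (𝓞 K)}

/-- **Splitting off a `w`-local factor inside `U(b', c)`**: if `B ι_w(a) ∈ U(b',c)` with `B_w = 1` then
`B ∈ U(b', c)` (`U` maximal above `p`, `w ∣ p`; the `w`-component `a` lies in `Iw_w(b',c)`, so
`ι_w(a) ∈ U`). [folklore] -/
theorem mem_level_of_mul_ofLocal_mem (h𝒰 : 𝒰.IsMaximalAbove) (hw : (p : 𝓞 K) ∈ w.asIdeal) {b' c : ℕ}
    {B : FiniteAdelicGL 2 K} (hB : localComponent 2 K w B = 1) {a : GL (Fin 2) (w.adicCompletion K)}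
    (h : B * ofLocal 2 K w a ∈ 𝒰.level b' c) : B ∈ 𝒰.level b' c := by
  have ha : a ∈ iwahoriLevel 2 w b' c := by
    have h2 := ((𝒰.mem_level_iff b' c _).1 h).2 w hw
    rwa [map_mul, hB, one_mul, localComponent_ofLocal] at h2
  have hofLocal : ofLocal 2 K w a ∈ 𝒰.level b' c :=
    𝒰.ofLocal_mem_levelAt h𝒰 hw (valuedIwahoriSubgroup_le_valuedCongruenceSubgroup_one ha)
      (Λ := fun v => iwahoriLevel 2 v.1 b' c) ha
  have h' := mul_mem h (inv_mem hofLocal)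
  rwa [mul_inv_cancel_right] at h'

/-- Removing the `w`-part of an element of `U(b', c)` stays in `U(b', c)` and kills the `w`-component.
[folklore] -/
theorem mul_ofLocal_inv_mem_level (h𝒰 : 𝒰.IsMaximalAbove) (hw : (p : 𝓞 K) ∈ w.asIdeal) {b' c : ℕ}
    {m : FiniteAdelicGL 2 K} (hm : m ∈ 𝒰.level b' c) :
    m * (ofLocal 2 K w (localComponent 2 K w m))⁻¹ ∈ 𝒰.level b' c ∧
      localComponent 2 K w (m * (ofLocal 2 K w (localComponent 2 K w m))⁻¹) = 1 := by
  refine ⟨?_, by rw [map_mul, map_inv, localComponent_ofLocal, mul_inv_cancel]⟩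
  have h := 𝒰.mul_ofLocal_inv_mul_ofLocal_mem_levelAt h𝒰 hw (Λ := fun v => iwahoriLevel 2 v.1 b' c)
    (Λ' := fun v => iwahoriLevel 2 v.1 b' c) hm (z := 1) (one_mem _) (one_mem _) (fun _ _ => le_rfl)
  rwa [map_one, mul_one] at h

/-- **`g U t_w^b ⊆ U g t_w^b U`** for `g` with trivial `w`-component (`U = U(b',c)`, `b ≤ c`).
[cite: ShimuraIATAF1971, Ch. 3, Prop. 3.3] -/
theorem mul_mul_heckeElement_pow_mem_doubleCosetQuot (h𝒰 : 𝒰.IsMaximalAbove)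
    (hw : (p : 𝓞 K) ∈ w.asIdeal) {b' c b : ℕ} (hb : b ≤ c) {g : FiniteAdelicGL 2 K}
    (hg : localComponent 2 K w g = 1) (l : FiniteAdelicGL 2 K) (hl : l ∈ 𝒰.level b' c) :
    ((g * l * heckeElement 2 K w 1 ^ b : FiniteAdelicGL 2 K) : FiniteAdelicGL 2 K ⧸ 𝒰.level b' c) ∈
      ArithmeticQuotient.doubleCosetQuot (𝒰.level b' c) (g * heckeElement 2 K w 1 ^ b) := by
  obtain ⟨y, hy1, hy⟩ := 𝒰.exists_globalUnipotent_coset_eq h𝒰 hw hb hl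
  have hcomm : g * globalUnipotent K w y = globalUnipotent K w y * g := mul_ofLocal_comm hg _
  have h1 : ((g * l * heckeElement 2 K w 1 ^ b : FiniteAdelicGL 2 K) : FiniteAdelicGL 2 K ⧸ 𝒰.level b' c) =
      (g : FiniteAdelicGL 2 K) • ((l * heckeElement 2 K w 1 ^ b : FiniteAdelicGL 2 K) :
        FiniteAdelicGL 2 K ⧸ 𝒰.level b' c) := by
    rw [MulAction.Quotient.smul_coe, smul_eq_mul, mul_assoc]
  rw [h1, hy, MulAction.Quotient.smul_coe, smul_eq_mul, ← mul_assoc, hcomm, mul_assoc]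
  change ((globalUnipotent K w y : FiniteAdelicGL 2 K)) •
      (((g * heckeElement 2 K w 1 ^ b : FiniteAdelicGL 2 K)) : FiniteAdelicGL 2 K ⧸ 𝒰.level b' c) ∈ _
  exact ArithmeticQuotient.coe_smul_mem_doubleCosetQuot (MulAction.mem_orbit_self _)
    ⟨globalUnipotent K w y, (𝒰.globalUnipotent_mem_level_iff h𝒰 hw b' c _).2 hy1⟩

/-- Normal form of `z • d` for `zU ∈ U g U / U` and `d ∈ U t_w^b U / U`: `z U = l g U` and
`z • d = l N_w(x) g t_w^b U` with `l ∈ U` and `x` integral. [folklore] -/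
theorem exists_normalForm_smul (h𝒰 : 𝒰.IsMaximalAbove) (hw : (p : 𝓞 K) ∈ w.asIdeal) {b' c b : ℕ}
    (hb : b ≤ c) {g : FiniteAdelicGL 2 K} (hg : localComponent 2 K w g = 1) (z : FiniteAdelicGL 2 K)
    (hz : (z : FiniteAdelicGL 2 K ⧸ 𝒰.level b' c) ∈ ArithmeticQuotient.doubleCosetQuot (𝒰.level b' c) g)
    (d : FiniteAdelicGL 2 K ⧸ 𝒰.level b' c)
    (hd : d ∈ ArithmeticQuotient.doubleCosetQuot (𝒰.level b' c) (heckeElement 2 K w 1 ^ b)) :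
    ∃ l ∈ 𝒰.level b' c, ∃ x : w.adicCompletion K, Valued.v x ≤ 1 ∧
      (z : FiniteAdelicGL 2 K ⧸ 𝒰.level b' c) = ((l * g : FiniteAdelicGL 2 K) : FiniteAdelicGL 2 K ⧸ 𝒰.level b' c) ∧
      z • d = ((l * globalUnipotent K w x * g * heckeElement 2 K w 1 ^ b : FiniteAdelicGL 2 K) :
        FiniteAdelicGL 2 K ⧸ 𝒰.level b' c) := by
  obtain ⟨l, hl, hlz⟩ := ArithmeticQuotient.exists_coe_mul_eq_of_mem_doubleCosetQuot (𝒰.level b' c) hz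
  have hu₀ : (l * g)⁻¹ * z ∈ 𝒰.level b' c := QuotientGroup.eq.1 hlz
  have hz_eq : z = l * g * ((l * g)⁻¹ * z) := (mul_inv_cancel_left _ _).symm
  obtain ⟨l', hl', hld⟩ := ArithmeticQuotient.exists_coe_mul_eq_of_mem_doubleCosetQuot (𝒰.level b' c) hd
  obtain ⟨x, hx1, hx⟩ := 𝒰.exists_globalUnipotent_coset_eq h𝒰 hw hb (mul_mem hu₀ hl')
  have hcomm : g * globalUnipotent K w x = globalUnipotent K w x * g := mul_ofLocal_comm hg _
  refine ⟨l, hl, x, hx1, hlz.symm, ?_⟩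
  have h1 : z • d = ((l * g : FiniteAdelicGL 2 K)) •
      ((((l * g)⁻¹ * z * l' * heckeElement 2 K w 1 ^ b : FiniteAdelicGL 2 K)) : FiniteAdelicGL 2 K ⧸ 𝒰.level b' c) := by
    rw [← hld, MulAction.Quotient.smul_coe, MulAction.Quotient.smul_coe, smul_eq_mul, smul_eq_mul]
    congr 1
    simp only [mul_assoc, mul_inv_cancel_left]
  rw [h1, hx, MulAction.Quotient.smul_coe, smul_eq_mul]
  congr 1
  simp only [← mul_assoc]
  rw [mul_assoc l g, hcomm, ← mul_assoc]

/-- Group-theoretic identity behind the separation argument: with `l⁻¹ l₁ = m'' M`,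
`N⁻¹ m'' = m'' N⁻¹`, `(N⁻¹ M N₁) g = g (N⁻¹ M N₁)` and `T⁻¹ (g⁻¹ m'' g) = (g⁻¹ m'' g) T⁻¹`,
`(l N g T)⁻¹ (l₁ N₁ g T) = (g⁻¹ m'' g) · (T⁻¹ (N⁻¹ M N₁) T)`. [folklore] -/
theorem conj_identity_of_commute {G : Type*} [Group G] {l l₁ g T N N₁ M m'' : G}
    (hm : l⁻¹ * l₁ = m'' * M) (c1 : N⁻¹ * m'' = m'' * N⁻¹)
    (c2 : N⁻¹ * M * N₁ * g = g * (N⁻¹ * M * N₁)) (c3 : T⁻¹ * (g⁻¹ * m'' * g) = g⁻¹ * m'' * g * T⁻¹) :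
    (l * N * g * T)⁻¹ * (l₁ * N₁ * g * T) = g⁻¹ * m'' * g * (T⁻¹ * (N⁻¹ * M * N₁) * T) := by
  have h1 : (l * N * g * T)⁻¹ * (l₁ * N₁ * g * T) = T⁻¹ * g⁻¹ * (N⁻¹ * (l⁻¹ * l₁)) * N₁ * g * T := by
    simp only [mul_inv_rev, mul_assoc]
  rw [h1, hm, ← mul_assoc N⁻¹, c1]
  have h2 : T⁻¹ * g⁻¹ * (m'' * N⁻¹ * M) * N₁ * g * T = T⁻¹ * (g⁻¹ * m'') * (N⁻¹ * M * N₁ * g) * T := by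
    simp only [mul_assoc]
  rw [h2, c2]
  have h3 : T⁻¹ * (g⁻¹ * m'') * (g * (N⁻¹ * M * N₁)) * T = T⁻¹ * (g⁻¹ * m'' * g) * ((N⁻¹ * M * N₁) * T) := by
    simp only [mul_assoc]
  rw [h3, c3]
  simp only [mul_assoc]

/-- `g⁻¹ (m'' M) g = (g⁻¹ m'' g) M` when `M g = g M`. [folklore] -/
theorem conj_mul_eq_of_commute {G : Type*} [Group G] {g M m'' : G} (c : M * g = g * M) :
    g⁻¹ * (m'' * M) * g = g⁻¹ * m'' * g * M := by
  simp only [mul_assoc, c]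

/-- **Separation across places**: `y • e = y' • e'` with `yU, y'U ∈ U g U/U` (`g_w = 1`) and
`e, e' ∈ U t_w^b U/U` forces `yU = y'U` (`U = U(b',c)`, `b ≤ c`). [cite: ShimuraIATAF1971, Ch. 3, Prop. 3.3] -/
theorem coe_eq_coe_of_smul_eq_smul_of_localComponent_eq_one (h𝒰 : 𝒰.IsMaximalAbove)
    (hw : (p : 𝓞 K) ∈ w.asIdeal) {b' c b : ℕ} (hb : b ≤ c) {g : FiniteAdelicGL 2 K}
    (hg : localComponent 2 K w g = 1) (y y' : FiniteAdelicGL 2 K)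
    (hy : (y : FiniteAdelicGL 2 K ⧸ 𝒰.level b' c) ∈ ArithmeticQuotient.doubleCosetQuot (𝒰.level b' c) g)
    (hy' : (y' : FiniteAdelicGL 2 K ⧸ 𝒰.level b' c) ∈ ArithmeticQuotient.doubleCosetQuot (𝒰.level b' c) g)
    (e : FiniteAdelicGL 2 K ⧸ 𝒰.level b' c)
    (he : e ∈ ArithmeticQuotient.doubleCosetQuot (𝒰.level b' c) (heckeElement 2 K w 1 ^ b))
    (e' : FiniteAdelicGL 2 K ⧸ 𝒰.level b' c)
    (he' : e' ∈ ArithmeticQuotient.doubleCosetQuot (𝒰.level b' c) (heckeElement 2 K w 1 ^ b))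
    (hee : y • e = y' • e') :
    (y : FiniteAdelicGL 2 K ⧸ 𝒰.level b' c) = (y' : FiniteAdelicGL 2 K ⧸ 𝒰.level b' c) := by
  obtain ⟨l, hl, x, -, hyx, hye⟩ := 𝒰.exists_normalForm_smul h𝒰 hw hb hg y hy e he
  obtain ⟨l₁, hl₁, x₁, -, hyx', hye'⟩ := 𝒰.exists_normalForm_smul h𝒰 hw hb hg y' hy' e' he'
  rw [hyx, hyx', QuotientGroup.eq,
    show (l * g)⁻¹ * (l₁ * g) = g⁻¹ * (l⁻¹ * l₁) * g by simp only [mul_inv_rev, mul_assoc]]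
  -- the element of `U` produced by `y • e = y' • e'`, in `ι_w`-form
  have hX : (l * ofLocal 2 K w (localUnipotent w x) * g * ofLocal 2 K w (cutDiag (uniformizerAt w ^ b) 1))⁻¹ *
      (l₁ * ofLocal 2 K w (localUnipotent w x₁) * g * ofLocal 2 K w (cutDiag (uniformizerAt w ^ b) 1)) ∈
        𝒰.level b' c := by
    rw [← heckeElement_one_pow_eq_ofLocal w b]
    exact QuotientGroup.eq.1 (hye.symm.trans (hee.trans hye'))
  -- split `m = l⁻¹ l₁ ∈ U` into the part `m''` off `w` and its `w`-part `ι_w(m_w)`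
  have hm : l⁻¹ * l₁ ∈ 𝒰.level b' c := mul_mem (inv_mem hl) hl₁
  obtain ⟨hm'', hm''w⟩ := 𝒰.mul_ofLocal_inv_mem_level h𝒰 hw hm
  have hm_eq : l⁻¹ * l₁ = l⁻¹ * l₁ * (ofLocal 2 K w (localComponent 2 K w (l⁻¹ * l₁)))⁻¹ *
      ofLocal 2 K w (localComponent 2 K w (l⁻¹ * l₁)) := by
    rw [inv_mul_cancel_right]
  -- commutation inputs (elements trivial at `w` commute with `w`-local elements)
  have c1 : (ofLocal 2 K w (localUnipotent w x))⁻¹ * (l⁻¹ * l₁ * (ofLocal 2 K w (localComponent 2 K w (l⁻¹ * l₁)))⁻¹) =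
      l⁻¹ * l₁ * (ofLocal 2 K w (localComponent 2 K w (l⁻¹ * l₁)))⁻¹ * (ofLocal 2 K w (localUnipotent w x))⁻¹ := by
    rw [← map_inv]
    exact (mul_ofLocal_comm hm''w (localUnipotent w x)⁻¹).symm
  have c2 : (ofLocal 2 K w (localUnipotent w x))⁻¹ * ofLocal 2 K w (localComponent 2 K w (l⁻¹ * l₁)) *
      ofLocal 2 K w (localUnipotent w x₁) * g =
      g * ((ofLocal 2 K w (localUnipotent w x))⁻¹ * ofLocal 2 K w (localComponent 2 K w (l⁻¹ * l₁)) *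
        ofLocal 2 K w (localUnipotent w x₁)) := by
    rw [← map_inv, ← map_mul, ← map_mul]
    exact (mul_ofLocal_comm hg _).symm
  have hBw : localComponent 2 K w (g⁻¹ * (l⁻¹ * l₁ * (ofLocal 2 K w (localComponent 2 K w (l⁻¹ * l₁)))⁻¹) * g) = 1 := by
    rw [map_mul, map_mul, map_inv, hg, hm''w, inv_one, one_mul, one_mul]
  have c3 : (ofLocal 2 K w (cutDiag (uniformizerAt w ^ b) 1))⁻¹ *
      (g⁻¹ * (l⁻¹ * l₁ * (ofLocal 2 K w (localComponent 2 K w (l⁻¹ * l₁)))⁻¹) * g) =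
      g⁻¹ * (l⁻¹ * l₁ * (ofLocal 2 K w (localComponent 2 K w (l⁻¹ * l₁)))⁻¹) * g *
        (ofLocal 2 K w (cutDiag (uniformizerAt w ^ b) 1))⁻¹ := by
    rw [← map_inv]
    exact (mul_ofLocal_comm hBw _).symm
  have hloc : ofLocal 2 K w ((cutDiag (uniformizerAt w ^ b) 1)⁻¹ *
      ((localUnipotent w x)⁻¹ * localComponent 2 K w (l⁻¹ * l₁) * localUnipotent w x₁) *
        cutDiag (uniformizerAt w ^ b) 1) =
      (ofLocal 2 K w (cutDiag (uniformizerAt w ^ b) 1))⁻¹ *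
        ((ofLocal 2 K w (localUnipotent w x))⁻¹ * ofLocal 2 K w (localComponent 2 K w (l⁻¹ * l₁)) *
          ofLocal 2 K w (localUnipotent w x₁)) * ofLocal 2 K w (cutDiag (uniformizerAt w ^ b) 1) := by
    simp only [map_mul, map_inv]
  rw [conj_identity_of_commute hm_eq c1 c2 c3, ← hloc] at hX
  have hB := 𝒰.mem_level_of_mul_ofLocal_mem h𝒰 hw hBw hX
  -- `g⁻¹ m g = (g⁻¹ m'' g) · ι_w(m_w)` with `ι_w(m_w) = m''⁻¹ m ∈ U`
  have hMw : ofLocal 2 K w (localComponent 2 K w (l⁻¹ * l₁)) ∈ 𝒰.level b' c := by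
    have h := mul_mem (inv_mem hm'') hm
    rwa [mul_inv_rev, inv_inv, mul_assoc, inv_mul_cancel, mul_one] at h
  rw [hm_eq, conj_mul_eq_of_commute (mul_ofLocal_comm hg _).symm]
  exact mul_mem hB hMw

/-- **`[U g U] ∘ [U t_w^b U] = [U (g t_w^b) U]` on `Fun(GL₂(𝔸_K^∞) ⧸ U(b',c), M)`** for `g` with
trivial `w`-component and `b ≤ c` (`U` maximal above `p`, `w ∣ p`). [cite: ShimuraIATAF1971, Ch. 3, Prop. 3.3]
[cite: KhareThorne2017, §6.2, Lemma 6.5 (3)] -/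
theorem heckeFun_level_comp_heckeElement_pow (k : Type) [CommRing k] (M : Type) [AddCommGroup M]
    [Module k M] (h𝒰 : 𝒰.IsMaximalAbove) (hw : (p : 𝓞 K) ∈ w.asIdeal) {b' c b : ℕ} (hb : b ≤ c)
    {g : FiniteAdelicGL 2 K} (hg : localComponent 2 K w g = 1) :
    ArithmeticQuotient.heckeFun k (𝒰.level b' c) g M ∘ₗ
        ArithmeticQuotient.heckeFun k (𝒰.level b' c) (heckeElement 2 K w 1 ^ b) M =
      ArithmeticQuotient.heckeFun k (𝒰.level b' c) (g * heckeElement 2 K w 1 ^ b) M :=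
  ArithmeticQuotient.heckeFun_comp_heckeFun k (𝒰.level b' c) M (finite_orbit_quotient (𝒰.level b' c) _)
    (finite_orbit_quotient (𝒰.level b' c) _) (finite_orbit_quotient (𝒰.level b' c) _)
    (fun l hl => 𝒰.mul_mul_heckeElement_pow_mem_doubleCosetQuot h𝒰 hw hb hg l hl)
    (fun y y' hy hy' e he e' he' hee =>
      𝒰.coe_eq_coe_of_smul_eq_smul_of_localComponent_eq_one h𝒰 hw hb hg y y' hy hy' e he e' he' hee)

/-- **On `H^i(X_{U(b',c)}, M)`: `heckeEnd g * heckeEnd (t_w^b) = heckeEnd (g t_w^b)`** for `g` with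
trivial `w`-component, `b ≤ c`. [cite: ShimuraIATAF1971, Ch. 3, Prop. 3.3] -/
theorem heckeEnd_level_mul_heckeElement_pow_of_localComponent_eq_one (k : Type) [CommRing k] (M : Type)
    [AddCommGroup M] [Module k M] {Γ : Type} [Group Γ] (ι : Γ →* FiniteAdelicGL 2 K)
    (h𝒰 : 𝒰.IsMaximalAbove) (hw : (p : 𝓞 K) ∈ w.asIdeal) {b' c b : ℕ} (hb : b ≤ c)
    {g : FiniteAdelicGL 2 K} (hg : localComponent 2 K w g = 1) (i : ℕ) :
    ArithmeticQuotient.heckeEnd k (𝒰.level b' c) g M ι i *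
        ArithmeticQuotient.heckeEnd k (𝒰.level b' c) (heckeElement 2 K w 1 ^ b) M ι i =
      ArithmeticQuotient.heckeEnd k (𝒰.level b' c) (g * heckeElement 2 K w 1 ^ b) M ι i := by
  have hrep : ArithmeticQuotient.heckeRepHom k (𝒰.level b' c) (g * heckeElement 2 K w 1 ^ b) M ι =
      ArithmeticQuotient.heckeRepHom k (𝒰.level b' c) (heckeElement 2 K w 1 ^ b) M ι ≫
        ArithmeticQuotient.heckeRepHom k (𝒰.level b' c) g M ι :=
    Rep.hom_ext (Representation.IntertwiningMap.ext
      (𝒰.heckeFun_level_comp_heckeElement_pow k M h𝒰 hw hb hg).symm)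
  rw [ArithmeticQuotient.heckeEnd, ArithmeticQuotient.heckeEnd, ArithmeticQuotient.heckeEnd,
    ArithmeticQuotient.heckeOperator, ArithmeticQuotient.heckeOperator, ArithmeticQuotient.heckeOperator, hrep,
    groupCohomology.map_id_comp, Module.End.mul_eq_comp, ModuleCat.hom_comp]

/-! ### The product `U_p^{(r)} = ∏_{v} U_{v,1}^r` -/

/-- **`∏_{v ∈ s} t_{v,1}^r`** (the factors commute). [cite: KhareThorne2017, §6.4] -/
def upElement (s : Finset (HeightOneSpectrum (𝓞 K))) (r : ℕ) : FiniteAdelicGL 2 K :=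
  s.noncommProd (fun v => heckeElement 2 K v 1 ^ r) fun v _ w _ _ => commute_heckeElement_pow v w r r

omit [Fact p.Prime] in
/-- The component of `∏_{v ∈ s} t_v^r` at a place outside `s` is trivial. [folklore] -/
theorem localComponent_upElement_of_not_mem {s : Finset (HeightOneSpectrum (𝓞 K))} {r : ℕ}
    {w : HeightOneSpectrum (𝓞 K)} (hw : w ∉ s) :
    localComponent 2 K w (upElement (K := K) s r) = 1 := by
  classical
  rw [upElement, Finset.map_noncommProd]
  refine (Finset.noncommProd_eq_pow_card s _ _ 1 fun v hv => ?_).trans (one_pow _)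
  rw [heckeElement_one_pow_eq_ofLocal v r, localComponent_ofLocal_of_ne (by rintro rfl; exact hw hv)]

/-- **`heckeEnd (∏_{v ∈ s} t_v^r) = ∏_{v ∈ s} (heckeEnd t_{v,1})^r` on `H^i(X_{U(b',c)}, M)`** for
`r ≤ c` and `s` a set of places above `p` (`U` maximal above `p`): the `U`-operators at the places
above `p` multiply. [cite: ShimuraIATAF1971, Ch. 3, Prop. 3.3] [cite: KhareThorne2017, §6.2, §6.4] -/
theorem heckeEnd_level_upElement (k : Type) [CommRing k] (M : Type) [AddCommGroup M] [Module k M]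
    (h𝒰 : 𝒰.IsMaximalAbove) {b' c r : ℕ} (hr : r ≤ c) (i : ℕ)
    (s : Finset (HeightOneSpectrum (𝓞 K))) (hs : ∀ v ∈ s, (p : 𝓞 K) ∈ v.asIdeal) :
    ArithmeticQuotient.heckeEnd k (𝒰.level b' c) (upElement s r) M (globalEmbedding 2 K) i =
      s.noncommProd (fun v => ArithmeticQuotient.heckeEnd k (𝒰.level b' c) (heckeElement 2 K v 1) M
          (globalEmbedding 2 K) i ^ r)
        fun v hv w hw' _ => (show Commute _ _ from 𝒰.heckeEnd_level_comm h𝒰 k M b' c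
          (𝒰.heckeElement_mem_hidaElements (Or.inr (hs v hv)) 1)
          (𝒰.heckeElement_mem_hidaElements (Or.inr (hs w hw')) 1) i).pow_pow r r := by
  classical
  induction s using Finset.induction_on with
  | empty =>
    rw [Finset.noncommProd_empty, upElement, Finset.noncommProd_empty]
    exact ArithmeticQuotient.heckeEnd_one k (globalEmbedding 2 K) (𝒰.level b' c) M i
  | insert w s hw ih =>
    have hs' : ∀ v ∈ s, (p : 𝓞 K) ∈ v.asIdeal := fun v hv => hs v (Finset.mem_insert_of_mem hv)
    have hwp : (p : 𝓞 K) ∈ w.asIdeal := hs w (Finset.mem_insert_self w s)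
    rw [Finset.noncommProd_insert_of_notMem _ _ _ _ hw, ← ih hs']
    have hup : upElement (insert w s) r = upElement s r * heckeElement 2 K w 1 ^ r := by
      rw [upElement, Finset.noncommProd_insert_of_notMem _ _ _ _ hw, upElement]
      exact (Finset.noncommProd_commute s _ _ _ fun v hv =>
        commute_heckeElement_pow w v r r).eq
    rw [hup, ← 𝒰.heckeEnd_level_mul_heckeElement_pow_of_localComponent_eq_one k M (globalEmbedding 2 K)
      h𝒰 hwp hr (localComponent_upElement_of_not_mem hw) i,
      𝒰.heckeEnd_level_heckeElement_pow k M (globalEmbedding 2 K) h𝒰 hwp hr i]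
    -- reorder the two commuting factors
    refine (Commute.eq ?_).symm
    refine Commute.pow_left ?_ r
    rw [ih hs']
    refine Finset.noncommProd_commute s _ _ _ fun v hv => ?_
    exact ((show Commute _ _ from 𝒰.heckeEnd_level_comm h𝒰 k M b' c
      (𝒰.heckeElement_mem_hidaElements (Or.inr hwp) 1)
      (𝒰.heckeElement_mem_hidaElements (Or.inr (hs' v hv)) 1) i).pow_right r)

end TameLevel

end Literature.NumberTheory.Automorphic.BigHeckeGLn
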